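import Summits.QuantumFields.YangMills.Theorems.BalabanUVNodesN07Prop8StepGuardedFlatWitness
import Summits.QuantumFields.YangMills.Theorems.BalabanUVNodesN07Thm1ScaledInterfaceInstance

/-!
# BalabanUVNodes ∕ N07 ([Balaban1985Variational] Prop. 8 p. 304; [Balaban1988Convergent] (2.1) p. 254, p. 257) — NON-VACUITY OF THE GRID-GUARDED STUB-1 TEXT (the V21-G
# CANDIDATE guard `A‴(c, c₀, c₁)`): the binder block of `Node00.Prop8RegSepTopStepG … A‴ …` IS INHABITED at the flat datum, for EVERY family and EVERY `(c, c₀, c₁)`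

Cell `pub-ymgap` (HUMAN RULINGS D-0062 ∕ D-0088), seat `pub-ymgap-dag-n07-e` generation 22 (R141 (C) row s3 lineage; DAG node N07 = [B11]; lane owner of the K0 road), MODULE 58.
`--kind proof --supports stmt-QuantumFields-20541 --as helper` (K0⁷; count-neutral).  THEOREMS ONLY (0 `def`, 0 `sorry`).  Companion of module 55 (p632562, the V20-G witness) for the
V21-G CANDIDATE of 2026-08-28 (lane LOCATED-CANDIDATE ∕ k0-s1-w3 LOCATED-STUB1-GRID-NUMERICS p645438 ∕ plan g86–g87 recipe): the four-conjunct guard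
`A‴(c, c₀, c₁) := fun ν M g K k _s => c ≤ ν.M₁ ∧ k + c₀ ≤ F.m + K ∧ F.L ^ c₁ ∣ M ∧ ∀ i, 1 ≤ i → i ≤ k → dCubeSide (F.P K).L M (RkOfRecord (F.P K).L ν.r (g i)) i ∣ (F.P K).sitesPerDir 0`
(p645438 :147–148, verbatim).  A re-texted stub `∃ c c₀ c₁ B₃ a₀ a₁, … ∧ Prop8RegSepTopStepG F 2 suppDom A‴ B₃ a₀ a₁` quantifies a guarded implication; referee practice (ref-G NOTE-1
on V20) asks that such a text be NON-VACUOUS — its binder block jointly satisfiable under the guard.  THIS FILE: (i) the guard `A‴` at given `(c, c₀, c₁)` is met by every prefix with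
`c ≤ ν.M₁`, `k + c₀ ≤ F.m + K`, `F.L ^ c₁ ∣ M` and torus-compatible blocks, whence module 55's generic flat inhabitant (`prop8RegSepTopStepG_binders_inhabited_flat`) passes it;
(ii) for EVERY family `F`, EVERY `(c, c₀, c₁)`, EVERY numerics template `ν₀` and EVERY coupling sequence `g` such a prefix EXISTS: `ν := {ν₀ with M₁ := c + 1, r := 0}` (so
`R_j = RkOfRecord L 0 (g j) = 1`, dag-n07-e g7's `RkOfRecord_zero_r`), `M := L^{c₁}`, `K := c₀ + c₁ + 1`, `k := 1` — then `dCubeSide L M R₁ 1 = L^{c₁+1} ∣ 2·L^{m+K}`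
(`T4Family.sitesPerDir_eq`) and `1 + c₀ ≤ m + K` — so the grid-guarded text's binder block is inhabited outright (A2 non-vacuity BY NAME), exactly as V19's and V20's were.
HONEST FRAMING: count-neutral kernel bookkeeping at the FLAT datum (`U ≡ 1`, `𝐖 ≡ 1`); Prop. 8 NOT claimed in any reading; nothing of Bałaban asserted; the guard `A‴` is a
CANDIDATE text (V20-G dead8a8df885c226 is the skeleton of record at filing time); `stub_prop8StepCoPG13` ∕ K0⁷ NOT closed; N07 NOT discharged (5∕27); counts unmoved (28∕28);
one finite 𝕋⁴ programme at fixed ε — R4 closes the conditional finite-𝕋⁴ rung `BalabanLadder.UV` only; NOT continuum ∕ ℝ⁴ ∕ OS ∕ mass gap ∕ Clay.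

DEPENDENCES (by name): module 55 `…N07Prop8StepFlatWitness.prop8RegSepTopStepG_binders_inhabited_flat` (module 32's flat inhabitant inside), dag-n07-e g7
`N07Thm1ScaledInterfaceInstance.RkOfRecord_zero_r`, `T4Family.sitesPerDir_eq`, def-R's `Node00.dCubeSide`.  [B11] = [Balaban1985Variational] Prop. 8 p.304, p.304 lines 1–2;
[III] = [Balaban1988Convergent] (2.1) p.254 («R_j … a power of L»), p.257 («partitions compatible with all other partitions»); [I] = [Balaban1987RG1] (0.1) p.251.
-/

noncomputable section

namespace Summit.QuantumFields.YangMills.BalabanUVNodes.N07Prop8StepFlatWitness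

open Literature.MathematicalPhysics.QuantumFieldTheory.Balaban1983to89
open Literature.MathematicalPhysics.QuantumFieldTheory.Balaban1983to89.T4Continuum (T4Family)
open Literature.MathematicalPhysics.QuantumFieldTheory.Balaban1983to89.B15DeterminingSets
open Literature.MathematicalPhysics.QuantumFieldTheory.Balaban1983to89.Node00
open Summit.QuantumFields.YangMills.BalabanUVNodes.N07Thm1ScaledInterfaceInstance (RkOfRecord_zero_r)
open scoped Matrix.Norms.L2Operator

section WitnessGrid

variable (F : T4Family) (N : ℕ) [NeZero N]

/-- ★ **THE GRID GUARD `A‴(c, c₀, c₁)` AT A COMPATIBLE PREFIX**: at any prefix with `c ≤ ν.M₁` (print p.304 lines 1–2), `k + c₀ ≤ F.m + K` ([I] (0.1): windows do not wrap),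
`F.L ^ c₁ ∣ M` ([III] p.254: the basic cube a power of `L`) and torus-compatible `𝐃_i`-blocks `L^i·M·R_i ∣ 2L^{m+K}` for `1 ≤ i ≤ k` ([III] p.257), the binder block of
`Prop8RegSepTopStepG F N Sup A‴ B₃ a₀ a₁` is inhabited at the flat datum, with its conclusion (module 55's generic witness, the guard read off the four hypotheses).
[cite: Balaban1985Variational, Prop. 8 p.304, p.304 lines 1–2; Balaban1988Convergent, (2.1) p.254, p.257; Balaban1987RG1, (0.1) p.251 (bookkeeping)] -/
theorem prop8RegSepTopStepG_gridGuard_binders_inhabited_flat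
    (Sup : (ν : Stage7Numerics) → (K : ℕ) → (ℕ → Set (Site (F.P K) 0)) → Set (Site (F.P K) 0)) (c c₀ c₁ : ℕ) {B₃ a₀ a₁ : ℝ} (hB₃ : 0 < B₃)
    (ha₀ : 0 < a₀) (ha₁ : 0 < a₁) (ν : Stage7Numerics) (hc : c ≤ ν.M₁) (hM₁ : 0 < ν.M₁) {M : ℕ} (hM : 1 ≤ M) (hdvd : F.L ^ c₁ ∣ M) (g : ℕ → ℝ) (K k : ℕ)
    (hk : 1 ≤ k) (hK : k + c₀ ≤ F.m + K)
    (hdiv : ∀ i, 1 ≤ i → i ≤ k → dCubeSide (F.P K).L M (RkOfRecord (F.P K).L ν.r (g i)) i ∣ (F.P K).sitesPerDir 0) :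
    ∃ (s : SeqOfRecord F ν M g K k) (ε₀ : ℝ) (δ : ℕ → ℝ) (W : MSField (F.P K) (SU N)) (U : GaugeField (F.P K) 0 (SU N)),
      Sect2.SeqSeparated ν.M₁ s ∧ 0 < ν.M₁ ∧
      (c ≤ ν.M₁ ∧ k + c₀ ≤ F.m + K ∧ F.L ^ c₁ ∣ M ∧ ∀ i, 1 ≤ i → i ≤ k → dCubeSide (F.P K).L M (RkOfRecord (F.P K).L ν.r (g i)) i ∣ (F.P K).sitesPerDir 0) ∧ 1 ≤ k ∧
      (∀ n, n ≤ k → 0 < δ n ∧ δ n ≤ a₁ ∧ B₃ * δ n ≤ ε₀) ∧ (∀ n, n < k → δ n ≤ 2 * δ (n + 1)) ∧ (∀ n, n < k → δ (n + 1) ≤ 2 * δ n) ∧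
      ε₀ ≤ a₀ ∧ Sect2.DataSmall7PTop (avOfRecord F N K) s.Ω (Sup ν K s.Ω) k δ W ∧
      (∀ n, n ≤ k → PlaqSmallOn (Sect2.omegaPlaqsTop s.Ω (Sup ν K s.Ω) n) (ε₀ * (F.P K).eta n ^ 2) U) ∧
      Sect2.CoDivClassOnTop s.Ω (Sup ν K s.Ω) k ε₀ U ∧ AgreeOn (genSet s.Ω k) (avgFamily (avOfRecord F N K) U) W ∧
      IsCritOnFibre F N K (genSet s.Ω k) W U ∧
      ((∀ n, n ≤ k → PlaqSmallOn (Sect2.omegaPlaqsTop s.Ω (Sup ν K s.Ω) n) (B₃ * δ n * (F.P K).eta n ^ 2) U) ∧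
        ∀ n, n ≤ k → Sect2.CoDivSmallOn (Sect2.omegaBondsTop s.Ω (Sup ν K s.Ω) n) (B₃ * δ n * (F.P K).eta n ^ 3) U) :=
  prop8RegSepTopStepG_binders_inhabited_flat F N Sup
    (fun ν M g K k _s => c ≤ ν.M₁ ∧ k + c₀ ≤ F.m + K ∧ F.L ^ c₁ ∣ M ∧
      ∀ i, 1 ≤ i → i ≤ k → dCubeSide (F.P K).L M (RkOfRecord (F.P K).L ν.r (g i)) i ∣ (F.P K).sitesPerDir 0)
    hB₃ ha₀ ha₁ ν hM₁ hM g K k hk fun _ => ⟨hc, hK, hdvd, hdiv⟩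

/-- ★★ **THE GRID-GUARDED STUB-1 TEXT IS AN INHABITED-IMPLICATION QUESTION FOR EVERY FAMILY, EVERY `(c, c₀, c₁)`, EVERY COUPLING SEQUENCE**: there is a prefix passing the guard
`A‴(c, c₀, c₁)` — numerics `ν := {ν₀ with M₁ := c + 1, r := 0}` (so `R_i = 1`, `RkOfRecord_zero_r`), basic cube `M := L^{c₁}`, `K := c₀ + c₁ + 1`, top level `k := 1` (so
`k + c₀ ≤ m + K` and `L¹·L^{c₁}·1 ∣ 2·L^{m+K}`) — at which the whole binder block of `Prop8RegSepTopStepG F N Sup A‴ B₃ a₀ a₁` is inhabited (flat datum, separated top index), with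
its conclusion.  A2 non-vacuity of the V21-G candidate text BY NAME. [cite: Balaban1985Variational, Prop. 8 p.304, p.304 lines 1–2; Balaban1988Convergent, (2.1) p.254, (2.5) p.255, p.257; Balaban1987RG1, (0.1) p.251 (bookkeeping)] -/
theorem prop8RegSepTopStepG_gridGuard_inhabited_flat
    (Sup : (ν : Stage7Numerics) → (K : ℕ) → (ℕ → Set (Site (F.P K) 0)) → Set (Site (F.P K) 0)) (c c₀ c₁ : ℕ) {B₃ a₀ a₁ : ℝ} (hB₃ : 0 < B₃)
    (ha₀ : 0 < a₀) (ha₁ : 0 < a₁) (ν₀ : Stage7Numerics) (g : ℕ → ℝ) :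
    ∃ (ν : Stage7Numerics) (M K k : ℕ) (s : SeqOfRecord F ν M g K k) (ε₀ : ℝ) (δ : ℕ → ℝ) (W : MSField (F.P K) (SU N)) (U : GaugeField (F.P K) 0 (SU N)),
      Sect2.SeqSeparated ν.M₁ s ∧ 0 < ν.M₁ ∧
      (c ≤ ν.M₁ ∧ k + c₀ ≤ F.m + K ∧ F.L ^ c₁ ∣ M ∧ ∀ i, 1 ≤ i → i ≤ k → dCubeSide (F.P K).L M (RkOfRecord (F.P K).L ν.r (g i)) i ∣ (F.P K).sitesPerDir 0) ∧ 1 ≤ k ∧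
      (∀ n, n ≤ k → 0 < δ n ∧ δ n ≤ a₁ ∧ B₃ * δ n ≤ ε₀) ∧ (∀ n, n < k → δ n ≤ 2 * δ (n + 1)) ∧ (∀ n, n < k → δ (n + 1) ≤ 2 * δ n) ∧
      ε₀ ≤ a₀ ∧ Sect2.DataSmall7PTop (avOfRecord F N K) s.Ω (Sup ν K s.Ω) k δ W ∧
      (∀ n, n ≤ k → PlaqSmallOn (Sect2.omegaPlaqsTop s.Ω (Sup ν K s.Ω) n) (ε₀ * (F.P K).eta n ^ 2) U) ∧
      Sect2.CoDivClassOnTop s.Ω (Sup ν K s.Ω) k ε₀ U ∧ AgreeOn (genSet s.Ω k) (avgFamily (avOfRecord F N K) U) W ∧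
      IsCritOnFibre F N K (genSet s.Ω k) W U ∧
      ((∀ n, n ≤ k → PlaqSmallOn (Sect2.omegaPlaqsTop s.Ω (Sup ν K s.Ω) n) (B₃ * δ n * (F.P K).eta n ^ 2) U) ∧
        ∀ n, n ≤ k → Sect2.CoDivSmallOn (Sect2.omegaBondsTop s.Ω (Sup ν K s.Ω) n) (B₃ * δ n * (F.P K).eta n ^ 3) U) := by
  have hL1 : 1 ≤ F.L := by have := F.hL11; omega
  have hK : 1 + c₀ ≤ F.m + (c₀ + c₁ + 1) := by have := F.hm; omega
  have hM : 1 ≤ F.L ^ c₁ := Nat.one_le_pow _ _ (by omega)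
  -- torus compatibility of the one block at the prefix: `L¹·L^{c₁}·1 ∣ 2·L^{m + (c₀ + c₁ + 1)}`
  have hdiv : ∀ i, 1 ≤ i → i ≤ 1 →
      dCubeSide (F.P (c₀ + c₁ + 1)).L (F.L ^ c₁) (RkOfRecord (F.P (c₀ + c₁ + 1)).L ({ ν₀ with M₁ := c + 1, r := 0 } : Stage7Numerics).r (g i)) i ∣
        (F.P (c₀ + c₁ + 1)).sitesPerDir 0 := by
    intro i hi1 hi2
    obtain rfl : i = 1 := le_antisymm hi2 hi1
    rw [T4Family.sitesPerDir_eq, dCubeSide, T4Family.P_L]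
    have hr : ({ ν₀ with M₁ := c + 1, r := 0 } : Stage7Numerics).r = 0 := rfl
    rw [hr, RkOfRecord_zero_r, mul_one, pow_one, ← pow_succ']
    exact Dvd.dvd.mul_left (pow_dvd_pow F.L (by omega)) 2
  obtain ⟨s, ε₀, δ, W, U, h⟩ := prop8RegSepTopStepG_gridGuard_binders_inhabited_flat F N Sup c c₀ c₁ hB₃ ha₀ ha₁ { ν₀ with M₁ := c + 1, r := 0 }
    (Nat.le_succ c) (Nat.succ_pos c) (M := F.L ^ c₁) hM dvd_rfl g (c₀ + c₁ + 1) 1 le_rfl hK hdiv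
  exact ⟨{ ν₀ with M₁ := c + 1, r := 0 }, F.L ^ c₁, c₀ + c₁ + 1, 1, s, ε₀, δ, W, U, h⟩

end WitnessGrid

end Summit.QuantumFields.YangMills.BalabanUVNodes.N07Prop8StepFlatWitness

end
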